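import Mathlib
import Literature.NumberTheory.Transcendental.KZCalculus
import Literature.NumberTheory.Transcendental.KZLogCalculusProofs
import Literature.NumberTheory.Transcendental.KZSemialgebraicComplex
import Literature.NumberTheory.Transcendental.SemialgebraicMapsProofs

/-!
# `HyperellipticRiemannRelation` (stmt-KontsevichZagierPeriods-3522), line `SketchIdeator2`:
# gap combinatorics and boundary phases for the stub `stub_faces`

Elementary bookkeeping for the six gaps `J₀ = (−∞,e₀), J₁ = (e₀,e₁), …, J₅ = (e₄,∞)` of five
strictly increasing rational branch points `e₀ < ⋯ < e₄` and for the boundary values of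
`Φ(z) = ∏ⱼ √(z − eⱼ)` (principal square roots) on the real axis:

* `Faces.gap_sign` — on `J_k` exactly the `k` roots `e_i`, `i < k`, lie to the left;
  consequences: the gaps are pairwise disjoint (`gap_unique`), ordered (`gap_lt`), avoid the roots
  (`gap_ne`) and cover the complement of the roots (`gap_cover`); they are `ℚ`-semialgebraic
  (`isSemialgebraic_gap`);
* `Faces.inv_Phi_gap` — **boundary phases**: for `t ∈ J_k`,
  `1/Φ(t) = ε_k / √|P(t)|` with `ε = (−i, 1, i, −1, −i, 1)` and `P(t) = ∏ⱼ (t − eⱼ)`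
  (`√(negative real) = i √|·|`, `Complex.sqrt_neg_of_nonneg`);
* `Faces.im_kernel_cell`, `Faces.re_kernel_col` (registered auxiliary stub `stub_facesGaps`) — the
  two face integrands of the line on the cells of the gap grid:
  `Im(x₁/(Φ(x₀)Φ(x₁))) = Im(ε_j ε_k) · x₁/√(|P(x₀)||P(x₁)|)` on `J_j × J_k` and
  `ρ(x₀) Re(x₁/Φ(x₁)) = Re(ε_k) · x₁/√(|P(x₀)||P(x₁)|)` on `ℝ × J_k`, `ρ = 1/√|P|`.

No definitions are introduced: `Φ`, `J`, `f`, `ρ` enter through defining hypotheses, exactly as in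
the line skeleton. References: Kontsevich–Zagier 2001, §1.2; Bochnak–Coste–Roy 1998, §2.1.
-/

noncomputable section

namespace Summit.KontsevichZagierPeriods.UnfoldedStokes.HyperellipticRiemannRelationLine

open Set MeasureTheory Filter Topology
open Literature.NumberTheory.Transcendental
open Literature.ModelTheory.ExponentialFields (IsSemialgebraic)

namespace Faces

/-! ## The six gaps -/

/-- **Position of the roots relative to a gap.** If `t` lies in the gap `J_k` then the roots
`e_i` with `i < k` lie to the left of `t` and the roots `e_i` with `k ≤ i` lie to the right of `t`
(`e` is strictly increasing). [folklore] -/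
theorem gap_sign (e : Fin 5 → ℚ) (he : StrictMono e) (J : Fin 6 → Set ℝ)
    (hJ : J = ![Set.Iio (e 0 : ℝ), Set.Ioo (e 0 : ℝ) (e 1 : ℝ),
        Set.Ioo (e 1 : ℝ) (e 2 : ℝ), Set.Ioo (e 2 : ℝ) (e 3 : ℝ), Set.Ioo (e 3 : ℝ) (e 4 : ℝ),
        Set.Ioi (e 4 : ℝ)])
    {k : Fin 6} {t : ℝ} (ht : t ∈ J k) (i : Fin 5) :
    ((i : ℕ) < (k : ℕ) → (e i : ℝ) < t) ∧ ((k : ℕ) ≤ (i : ℕ) → t < (e i : ℝ)) := by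
  have hmono : ∀ a b : Fin 5, a ≤ b → (e a : ℝ) ≤ (e b : ℝ) := fun a b h => by
    exact_mod_cast he.monotone h
  subst hJ
  fin_cases k
  · simp only [Fin.zero_eta, Fin.isValue, Matrix.cons_val_zero, mem_Iio] at ht
    refine ⟨fun hi => absurd hi (Nat.not_lt_zero _), fun _ => lt_of_lt_of_le ht (hmono 0 i ?_)⟩
    exact Fin.zero_le i
  · simp only [Fin.mk_one, Fin.isValue, Matrix.cons_val_one, Matrix.cons_val_zero, mem_Ioo] at ht
    refine ⟨fun hi => lt_of_le_of_lt (hmono i 0 ?_) ht.1, fun hi => lt_of_lt_of_le ht.2 (hmono 1 i ?_)⟩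
    · exact Fin.le_def.mpr (by simpa using hi)
    · exact Fin.le_def.mpr (by simpa using hi)
  · simp only [Fin.reduceFinMk, Fin.isValue, Matrix.cons_val, mem_Ioo] at ht
    refine ⟨fun hi => lt_of_le_of_lt (hmono i 1 ?_) ht.1, fun hi => lt_of_lt_of_le ht.2 (hmono 2 i ?_)⟩
    · exact Fin.le_def.mpr (by simp at hi ⊢; omega)
    · exact Fin.le_def.mpr (by simpa using hi)
  · simp only [Fin.reduceFinMk, Fin.isValue, Matrix.cons_val, mem_Ioo] at ht
    refine ⟨fun hi => lt_of_le_of_lt (hmono i 2 ?_) ht.1, fun hi => lt_of_lt_of_le ht.2 (hmono 3 i ?_)⟩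
    · exact Fin.le_def.mpr (by simp at hi ⊢; omega)
    · exact Fin.le_def.mpr (by simpa using hi)
  · simp only [Fin.reduceFinMk, Fin.isValue, Matrix.cons_val, mem_Ioo] at ht
    refine ⟨fun hi => lt_of_le_of_lt (hmono i 3 ?_) ht.1, fun hi => lt_of_lt_of_le ht.2 (hmono 4 i ?_)⟩
    · exact Fin.le_def.mpr (by simp at hi ⊢; omega)
    · exact Fin.le_def.mpr (by simpa using hi)
  · simp only [Fin.reduceFinMk, Fin.isValue, Matrix.cons_val, mem_Ioi] at ht
    refine ⟨fun _ => lt_of_le_of_lt (hmono i 4 ?_) ht, fun hi => ?_⟩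
    · exact Fin.le_def.mpr (by have := i.isLt; simp; omega)
    · exact absurd i.isLt (not_lt.mpr (by simpa using hi))

/-- A gap avoids the roots. [folklore] -/
theorem gap_ne (e : Fin 5 → ℚ) (he : StrictMono e) (J : Fin 6 → Set ℝ)
    (hJ : J = ![Set.Iio (e 0 : ℝ), Set.Ioo (e 0 : ℝ) (e 1 : ℝ),
        Set.Ioo (e 1 : ℝ) (e 2 : ℝ), Set.Ioo (e 2 : ℝ) (e 3 : ℝ), Set.Ioo (e 3 : ℝ) (e 4 : ℝ),
        Set.Ioi (e 4 : ℝ)])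
    {k : Fin 6} {t : ℝ} (ht : t ∈ J k) (i : Fin 5) : t ≠ (e i : ℝ) := by
  obtain ⟨h1, h2⟩ := gap_sign e he J hJ ht i
  rcases lt_or_ge (i : ℕ) (k : ℕ) with h | h
  · exact (h1 h).ne'
  · exact (h2 h).ne

/-- Two gaps `J_j`, `J_k` with `j < k` are ordered: every point of `J_j` lies to the left of every
point of `J_k` (the root `e_j` separates them). [folklore] -/
theorem gap_lt (e : Fin 5 → ℚ) (he : StrictMono e) (J : Fin 6 → Set ℝ)
    (hJ : J = ![Set.Iio (e 0 : ℝ), Set.Ioo (e 0 : ℝ) (e 1 : ℝ),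
        Set.Ioo (e 1 : ℝ) (e 2 : ℝ), Set.Ioo (e 2 : ℝ) (e 3 : ℝ), Set.Ioo (e 3 : ℝ) (e 4 : ℝ),
        Set.Ioi (e 4 : ℝ)])
    {j k : Fin 6} (hjk : j < k) {s t : ℝ} (hs : s ∈ J j) (ht : t ∈ J k) : s < t := by
  have hj5 : (j : ℕ) < 5 := by have := k.isLt; omega
  have h1 := (gap_sign e he J hJ hs ⟨j, hj5⟩).2 le_rfl
  have h2 := (gap_sign e he J hJ ht ⟨j, hj5⟩).1 (by simpa using hjk)
  exact h1.trans h2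

/-- The gaps are pairwise disjoint. [folklore] -/
theorem gap_unique (e : Fin 5 → ℚ) (he : StrictMono e) (J : Fin 6 → Set ℝ)
    (hJ : J = ![Set.Iio (e 0 : ℝ), Set.Ioo (e 0 : ℝ) (e 1 : ℝ),
        Set.Ioo (e 1 : ℝ) (e 2 : ℝ), Set.Ioo (e 2 : ℝ) (e 3 : ℝ), Set.Ioo (e 3 : ℝ) (e 4 : ℝ),
        Set.Ioi (e 4 : ℝ)])
    {j k : Fin 6} {t : ℝ} (hj : t ∈ J j) (hk : t ∈ J k) : j = k := by
  rcases lt_trichotomy j k with h | h | h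
  · exact absurd (gap_lt e he J hJ h hj hk) (lt_irrefl t)
  · exact h
  · exact absurd (gap_lt e he J hJ h hk hj) (lt_irrefl t)

/-- The gaps cover the complement of the roots. [folklore] -/
theorem gap_cover (e : Fin 5 → ℚ) (J : Fin 6 → Set ℝ)
    (hJ : J = ![Set.Iio (e 0 : ℝ), Set.Ioo (e 0 : ℝ) (e 1 : ℝ),
        Set.Ioo (e 1 : ℝ) (e 2 : ℝ), Set.Ioo (e 2 : ℝ) (e 3 : ℝ), Set.Ioo (e 3 : ℝ) (e 4 : ℝ),
        Set.Ioi (e 4 : ℝ)])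
    {t : ℝ} (ht : ∀ i, t ≠ (e i : ℝ)) : ∃ k, t ∈ J k := by
  subst hJ
  rcases lt_or_gt_of_ne (ht 0) with h0 | h0
  · exact ⟨0, by simpa using h0⟩
  rcases lt_or_gt_of_ne (ht 1) with h1 | h1
  · exact ⟨1, by simp [h0, h1]⟩
  rcases lt_or_gt_of_ne (ht 2) with h2 | h2
  · exact ⟨2, by simp [h1, h2]⟩
  rcases lt_or_gt_of_ne (ht 3) with h3 | h3
  · exact ⟨3, by simp [h2, h3]⟩
  rcases lt_or_gt_of_ne (ht 4) with h4 | h4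
  · exact ⟨4, by simp [h3, h4]⟩
  · exact ⟨5, by simpa using h4⟩

/-- The gaps, read in any coordinate of `ℝⁿ`, are `ℚ`-semialgebraic (rational endpoints).
[cite: BochnakCosteRoy1998, Def. 2.1.4] -/
theorem isSemialgebraic_gap (e : Fin 5 → ℚ) (J : Fin 6 → Set ℝ)
    (hJ : J = ![Set.Iio (e 0 : ℝ), Set.Ioo (e 0 : ℝ) (e 1 : ℝ),
        Set.Ioo (e 1 : ℝ) (e 2 : ℝ), Set.Ioo (e 2 : ℝ) (e 3 : ℝ), Set.Ioo (e 3 : ℝ) (e 4 : ℝ),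
        Set.Ioi (e 4 : ℝ)])
    (k : Fin 6) {n : ℕ} (i : Fin n) : IsSemialgebraic ℚ {p : Fin n → ℝ | p i ∈ J k} := by
  have hlt : ∀ q : ℚ, IsSemialgebraic ℚ {p : Fin n → ℝ | p i < (q : ℝ)} := fun q => by
    simpa using Literature.ModelTheory.ExponentialFields.isSemialgebraic_setOf_eval_lt
      (k := ℚ) (R := ℝ) (MvPolynomial.X i) (MvPolynomial.C q)
  have hgt : ∀ q : ℚ, IsSemialgebraic ℚ {p : Fin n → ℝ | (q : ℝ) < p i} := fun q => by
    simpa using Literature.ModelTheory.ExponentialFields.isSemialgebraic_setOf_eval_lt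
      (k := ℚ) (R := ℝ) (MvPolynomial.C q) (MvPolynomial.X i)
  have hIoo : ∀ a b : ℚ, IsSemialgebraic ℚ {p : Fin n → ℝ | p i ∈ Set.Ioo (a : ℝ) (b : ℝ)} :=
    fun a b => by
      convert (hgt a).inter (hlt b) using 1
      ext p
      simp
  subst hJ
  fin_cases k
  · simpa using hlt (e 0)
  · simpa using hIoo (e 0) (e 1)
  · simpa using hIoo (e 1) (e 2)
  · simpa using hIoo (e 2) (e 3)
  · simpa using hIoo (e 3) (e 4)
  · simpa using hgt (e 4)

/-! ## Boundary phases of `Φ = ∏ⱼ √(z − eⱼ)` on the real axis -/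

/-- The principal square root of a non-negative real number is its real square root.
[folklore] -/
theorem sqrt_ofReal_of_nonneg {a : ℝ} (ha : 0 ≤ a) : Complex.sqrt (a : ℂ) = ((Real.sqrt a : ℝ) : ℂ) := by
  rw [Complex.sqrt_of_nonneg (Complex.zero_le_real.mpr ha), Complex.ofReal_re]

/-- The principal square root of a non-positive real number `a` is `i √(−a)`
(`Complex.sqrt_neg_of_nonneg`). [folklore] -/
theorem sqrt_ofReal_of_nonpos {a : ℝ} (ha : a ≤ 0) :
    Complex.sqrt (a : ℂ) = Complex.I * ((Real.sqrt (-a) : ℝ) : ℂ) := by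
  have h : (a : ℂ) = -((-a : ℝ) : ℂ) := by push_cast; ring
  rw [h, Complex.sqrt_neg_of_nonneg (Complex.zero_le_real.mpr (neg_nonneg.mpr ha)),
    Complex.sqrt_of_nonneg (Complex.zero_le_real.mpr (neg_nonneg.mpr ha)), Complex.ofReal_re]

/-- One factor of `Φ` on the gap `J_k`: `√(t − e_i) = √|t − e_i|` for the roots to the left
(`i < k`) and `√(t − e_i) = i √|t − e_i|` for the roots to the right (`k ≤ i`). [folklore] -/
theorem sqrt_sub_root (e : Fin 5 → ℚ) (he : StrictMono e) (J : Fin 6 → Set ℝ)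
    (hJ : J = ![Set.Iio (e 0 : ℝ), Set.Ioo (e 0 : ℝ) (e 1 : ℝ),
        Set.Ioo (e 1 : ℝ) (e 2 : ℝ), Set.Ioo (e 2 : ℝ) (e 3 : ℝ), Set.Ioo (e 3 : ℝ) (e 4 : ℝ),
        Set.Ioi (e 4 : ℝ)])
    {k : Fin 6} {t : ℝ} (ht : t ∈ J k) (i : Fin 5) :
    Complex.sqrt ((t : ℂ) - ((e i : ℝ) : ℂ)) =
      (if (i : ℕ) < (k : ℕ) then (1 : ℂ) else Complex.I) * ((Real.sqrt |t - (e i : ℝ)| : ℝ) : ℂ) := by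
  obtain ⟨h1, h2⟩ := gap_sign e he J hJ ht i
  have hcast : (t : ℂ) - ((e i : ℝ) : ℂ) = ((t - (e i : ℝ) : ℝ) : ℂ) := by push_cast; ring
  rw [hcast]
  split_ifs with h
  · have hpos : 0 ≤ t - (e i : ℝ) := (sub_pos.mpr (h1 h)).le
    rw [sqrt_ofReal_of_nonneg hpos, abs_of_nonneg hpos, one_mul]
  · have hneg : t - (e i : ℝ) ≤ 0 := (sub_neg.mpr (h2 (not_lt.mp h))).le
    rw [sqrt_ofReal_of_nonpos hneg, abs_of_nonpos hneg]

/-- **`Φ` on a gap.** For `t ∈ J_k`: `Φ(t) = i^{5−k} √|P(t)|`, `P(t) = ∏ⱼ (t − eⱼ)`. [folklore] -/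
theorem Phi_gap (e : Fin 5 → ℚ) (he : StrictMono e)
    (Φ : ℂ → ℂ) (hΦ : ∀ z, Φ z = ∏ j : Fin 5, Complex.sqrt (z - ((e j : ℝ) : ℂ)))
    (J : Fin 6 → Set ℝ)
    (hJ : J = ![Set.Iio (e 0 : ℝ), Set.Ioo (e 0 : ℝ) (e 1 : ℝ),
        Set.Ioo (e 1 : ℝ) (e 2 : ℝ), Set.Ioo (e 2 : ℝ) (e 3 : ℝ), Set.Ioo (e 3 : ℝ) (e 4 : ℝ),
        Set.Ioi (e 4 : ℝ)])
    {k : Fin 6} {t : ℝ} (ht : t ∈ J k) :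
    Φ (t : ℂ) = Complex.I ^ (5 - (k : ℕ)) *
      ((Real.sqrt |∏ i : Fin 5, (t - (e i : ℝ))| : ℝ) : ℂ) := by
  have hphase : (∏ i : Fin 5, if (i : ℕ) < (k : ℕ) then (1 : ℂ) else Complex.I) =
      Complex.I ^ (5 - (k : ℕ)) := by
    fin_cases k <;> simp [Fin.prod_univ_five]
  rw [hΦ]
  simp_rw [sqrt_sub_root e he J hJ ht]
  rw [Finset.prod_mul_distrib, hphase, ← Complex.ofReal_prod,
    ← Real.sqrt_prod _ (fun i _ => abs_nonneg _), ← Finset.abs_prod]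

/-- **Boundary phases** (the key pointwise fact of the faces): for `t` in the gap `J_k`,
`1/Φ(t) = ε_k/√|P(t)|` with `ε = (−i, 1, i, −1, −i, 1)` (`= i^{−(5−k)}`). [folklore] -/
theorem inv_Phi_gap (e : Fin 5 → ℚ) (he : StrictMono e)
    (Φ : ℂ → ℂ) (hΦ : ∀ z, Φ z = ∏ j : Fin 5, Complex.sqrt (z - ((e j : ℝ) : ℂ)))
    (J : Fin 6 → Set ℝ)
    (hJ : J = ![Set.Iio (e 0 : ℝ), Set.Ioo (e 0 : ℝ) (e 1 : ℝ),
        Set.Ioo (e 1 : ℝ) (e 2 : ℝ), Set.Ioo (e 2 : ℝ) (e 3 : ℝ), Set.Ioo (e 3 : ℝ) (e 4 : ℝ),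
        Set.Ioi (e 4 : ℝ)])
    {k : Fin 6} {t : ℝ} (ht : t ∈ J k) :
    (Φ (t : ℂ))⁻¹ = (![-Complex.I, 1, Complex.I, -1, -Complex.I, 1] : Fin 6 → ℂ) k *
      (((Real.sqrt |∏ i : Fin 5, (t - (e i : ℝ))|)⁻¹ : ℝ) : ℂ) := by
  have hphase : (Complex.I ^ (5 - (k : ℕ)))⁻¹ =
      (![-Complex.I, 1, Complex.I, -1, -Complex.I, 1] : Fin 6 → ℂ) k := by
    fin_cases k <;> simp [pow_succ, Complex.inv_I]
  rw [Phi_gap e he Φ hΦ J hJ ht, mul_inv, hphase, Complex.ofReal_inv]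

/-- The phase products `ε_j ε_k`, `ε = (−i, 1, i, −1, −i, 1)`, have imaginary part `0`, `1` or
`−1`. [folklore] -/
theorem phase_im_cases (j k : Fin 6) :
    (((![-Complex.I, 1, Complex.I, -1, -Complex.I, 1] : Fin 6 → ℂ) j *
        (![-Complex.I, 1, Complex.I, -1, -Complex.I, 1] : Fin 6 → ℂ) k).im = 0 ∨
      ((![-Complex.I, 1, Complex.I, -1, -Complex.I, 1] : Fin 6 → ℂ) j *
        (![-Complex.I, 1, Complex.I, -1, -Complex.I, 1] : Fin 6 → ℂ) k).im = 1) ∨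
      ((![-Complex.I, 1, Complex.I, -1, -Complex.I, 1] : Fin 6 → ℂ) j *
        (![-Complex.I, 1, Complex.I, -1, -Complex.I, 1] : Fin 6 → ℂ) k).im = -1 := by
  fin_cases j <;> fin_cases k <;> simp

/-- The phase products `ε_j ε_k` have INTEGER imaginary parts. [folklore] -/
theorem phase_im_int (j k : Fin 6) :
    ∃ n : ℤ, (n : ℝ) = ((![-Complex.I, 1, Complex.I, -1, -Complex.I, 1] : Fin 6 → ℂ) j *
      (![-Complex.I, 1, Complex.I, -1, -Complex.I, 1] : Fin 6 → ℂ) k).im := by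
  rcases phase_im_cases j k with (h | h) | h
  exacts [⟨0, by rw [h]; norm_num⟩, ⟨1, by rw [h]; norm_num⟩, ⟨-1, by rw [h]; norm_num⟩]

/-- The phases `ε_k` have real part `0`, `1` or `−1`. [folklore] -/
theorem phase_re_cases (k : Fin 6) :
    (((![-Complex.I, 1, Complex.I, -1, -Complex.I, 1] : Fin 6 → ℂ) k).re = 0 ∨
      ((![-Complex.I, 1, Complex.I, -1, -Complex.I, 1] : Fin 6 → ℂ) k).re = 1) ∨
      ((![-Complex.I, 1, Complex.I, -1, -Complex.I, 1] : Fin 6 → ℂ) k).re = -1 := by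
  fin_cases k <;> simp

/-- The phases `ε_k` have INTEGER real parts. [folklore] -/
theorem phase_re_int (k : Fin 6) :
    ∃ n : ℤ, (n : ℝ) = ((![-Complex.I, 1, Complex.I, -1, -Complex.I, 1] : Fin 6 → ℂ) k).re := by
  rcases phase_re_cases k with (h | h) | h
  exacts [⟨0, by rw [h]; norm_num⟩, ⟨1, by rw [h]; norm_num⟩, ⟨-1, by rw [h]; norm_num⟩]

/-! ## The two face integrands on the cells of the gap grid -/

/-- **Simplex-face integrand on a cell.** On `J_j × J_k` the kernel `Im(x₁/(Φ(x₀)Φ(x₁)))` equals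
`Im(ε_j ε_k) · x₁/√(|P(x₀)||P(x₁)|)`. [folklore] -/
theorem im_kernel_cell (e : Fin 5 → ℚ) (he : StrictMono e)
    (Φ : ℂ → ℂ) (hΦ : ∀ z, Φ z = ∏ j : Fin 5, Complex.sqrt (z - ((e j : ℝ) : ℂ)))
    (J : Fin 6 → Set ℝ)
    (hJ : J = ![Set.Iio (e 0 : ℝ), Set.Ioo (e 0 : ℝ) (e 1 : ℝ),
        Set.Ioo (e 1 : ℝ) (e 2 : ℝ), Set.Ioo (e 2 : ℝ) (e 3 : ℝ), Set.Ioo (e 3 : ℝ) (e 4 : ℝ),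
        Set.Ioi (e 4 : ℝ)])
    (f : (Fin 2 → ℝ) → ℝ) (hf : ∀ x, f x =
        x 1 / Real.sqrt (|∏ i : Fin 5, (x 0 - (e i : ℝ))| * |∏ i : Fin 5, (x 1 - (e i : ℝ))|))
    {j k : Fin 6} {x : Fin 2 → ℝ} (h0 : x 0 ∈ J j) (h1 : x 1 ∈ J k) :
    (((x 1 : ℝ) : ℂ) / (Φ ((x 0 : ℝ) : ℂ) * Φ ((x 1 : ℝ) : ℂ))).im =
      ((![-Complex.I, 1, Complex.I, -1, -Complex.I, 1] : Fin 6 → ℂ) j *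
        (![-Complex.I, 1, Complex.I, -1, -Complex.I, 1] : Fin 6 → ℂ) k).im * f x := by
  set ε : Fin 6 → ℂ := ![-Complex.I, 1, Complex.I, -1, -Complex.I, 1] with hε
  set a : ℝ := Real.sqrt |∏ i : Fin 5, (x 0 - (e i : ℝ))| with ha
  set b : ℝ := Real.sqrt |∏ i : Fin 5, (x 1 - (e i : ℝ))| with hb
  rw [div_eq_mul_inv, mul_inv, inv_Phi_gap e he Φ hΦ J hJ h0, inv_Phi_gap e he Φ hΦ J hJ h1, hf]
  have key : ((x 1 : ℝ) : ℂ) * (ε j * ((a⁻¹ : ℝ) : ℂ) * (ε k * ((b⁻¹ : ℝ) : ℂ))) =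
      (ε j * ε k) * ((x 1 * a⁻¹ * b⁻¹ : ℝ) : ℂ) := by
    push_cast
    ring
  rw [key, Complex.im_mul_ofReal, Real.sqrt_mul (abs_nonneg _)]
  rw [← ha, ← hb]
  ring

/-- **Column-face integrand on a cell.** On `ℝ × J_k` (first coordinate off the roots or not) the
kernel `ρ(x₀) Re(x₁/Φ(x₁))`, `ρ = 1/√|P|`, equals `Re(ε_k) · x₁/√(|P(x₀)||P(x₁)|)`. [folklore] -/
theorem re_kernel_col (e : Fin 5 → ℚ) (he : StrictMono e)
    (Φ : ℂ → ℂ) (hΦ : ∀ z, Φ z = ∏ j : Fin 5, Complex.sqrt (z - ((e j : ℝ) : ℂ)))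
    (J : Fin 6 → Set ℝ)
    (hJ : J = ![Set.Iio (e 0 : ℝ), Set.Ioo (e 0 : ℝ) (e 1 : ℝ),
        Set.Ioo (e 1 : ℝ) (e 2 : ℝ), Set.Ioo (e 2 : ℝ) (e 3 : ℝ), Set.Ioo (e 3 : ℝ) (e 4 : ℝ),
        Set.Ioi (e 4 : ℝ)])
    (f : (Fin 2 → ℝ) → ℝ) (hf : ∀ x, f x =
        x 1 / Real.sqrt (|∏ i : Fin 5, (x 0 - (e i : ℝ))| * |∏ i : Fin 5, (x 1 - (e i : ℝ))|))
    (ρ : ℝ → ℝ) (hρ : ∀ t, ρ t = 1 / Real.sqrt |∏ i : Fin 5, (t - (e i : ℝ))|)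
    {k : Fin 6} {x : Fin 2 → ℝ} (h1 : x 1 ∈ J k) :
    ρ (x 0) * ((((x 1 : ℝ) : ℂ) / Φ ((x 1 : ℝ) : ℂ))).re =
      ((![-Complex.I, 1, Complex.I, -1, -Complex.I, 1] : Fin 6 → ℂ) k).re * f x := by
  set ε : Fin 6 → ℂ := ![-Complex.I, 1, Complex.I, -1, -Complex.I, 1] with hε
  set a : ℝ := Real.sqrt |∏ i : Fin 5, (x 0 - (e i : ℝ))| with ha
  set b : ℝ := Real.sqrt |∏ i : Fin 5, (x 1 - (e i : ℝ))| with hb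
  rw [div_eq_mul_inv, inv_Phi_gap e he Φ hΦ J hJ h1, hf, hρ]
  have key : ((x 1 : ℝ) : ℂ) * (ε k * ((b⁻¹ : ℝ) : ℂ)) = ε k * ((x 1 * b⁻¹ : ℝ) : ℂ) := by
    push_cast
    ring
  rw [key, Complex.re_mul_ofReal, Real.sqrt_mul (abs_nonneg _)]
  rw [← ha, ← hb]
  ring

end Faces

/-- **Registered auxiliary stub `stub_facesGaps` (boundary phases on the gap grid).** With
`ε = (−i, 1, i, −1, −i, 1)`, `f(x) = x₁/√(|P(x₀)||P(x₁)|)`, `ρ = 1/√|P|`: on `J_j × J_k`,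
`Im(x₁/(Φ(x₀)Φ(x₁))) = Im(ε_j ε_k) f(x)`, and on `ℝ × J_k`, `ρ(x₀) Re(x₁/Φ(x₁)) = Re(ε_k) f(x)`.
[folklore] -/
theorem stub_facesGaps :
    ∀ (e : Fin 5 → ℚ), StrictMono e →
    ∀ (Φ : ℂ → ℂ), (∀ z, Φ z = ∏ j : Fin 5, Complex.sqrt (z - ((e j : ℝ) : ℂ))) →
    ∀ (J : Fin 6 → Set ℝ), J = ![Set.Iio (e 0 : ℝ), Set.Ioo (e 0 : ℝ) (e 1 : ℝ),
        Set.Ioo (e 1 : ℝ) (e 2 : ℝ), Set.Ioo (e 2 : ℝ) (e 3 : ℝ), Set.Ioo (e 3 : ℝ) (e 4 : ℝ),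
        Set.Ioi (e 4 : ℝ)] →
    ∀ (f : (Fin 2 → ℝ) → ℝ), (∀ x, f x =
        x 1 / Real.sqrt (|∏ i : Fin 5, (x 0 - (e i : ℝ))| * |∏ i : Fin 5, (x 1 - (e i : ℝ))|)) →
    ∀ (ρ : ℝ → ℝ), (∀ t, ρ t = 1 / Real.sqrt |∏ i : Fin 5, (t - (e i : ℝ))|) →
    ∀ (j k : Fin 6) (x : Fin 2 → ℝ), x 0 ∈ J j → x 1 ∈ J k →
      (((x 1 : ℝ) : ℂ) / (Φ ((x 0 : ℝ) : ℂ) * Φ ((x 1 : ℝ) : ℂ))).im =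
        ((![-Complex.I, 1, Complex.I, -1, -Complex.I, 1] : Fin 6 → ℂ) j *
          (![-Complex.I, 1, Complex.I, -1, -Complex.I, 1] : Fin 6 → ℂ) k).im * f x ∧
      ρ (x 0) * ((((x 1 : ℝ) : ℂ) / Φ ((x 1 : ℝ) : ℂ))).re =
        ((![-Complex.I, 1, Complex.I, -1, -Complex.I, 1] : Fin 6 → ℂ) k).re * f x := by
  intro e he Φ hΦ J hJ f hf ρ hρ j k x h0 h1
  exact ⟨Faces.im_kernel_cell e he Φ hΦ J hJ f hf h0 h1,
    Faces.re_kernel_col e he Φ hΦ J hJ f hf ρ hρ h1⟩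

end Summit.KontsevichZagierPeriods.UnfoldedStokes.HyperellipticRiemannRelationLine
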